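import Summits.AtomisticToContinuum.HydrodynamicLimit.Theorems.AntiMazurCoboundariesKineticFluxLdDecayWindowMonotone
import Summits.AtomisticToContinuum.HydrodynamicLimit.Theses.FluxGibbsianityLdDrude
import Summits.AtomisticToContinuum.HydrodynamicLimit.Theorems.JParityClosureOddContactSymmetryGibbsInvariance
import Literature.MathematicalPhysics.KineticTheory.HardSphereTwoTimePressure
import Literature.MathematicalPhysics.KineticTheory.HardSphereEulerProofs
import HarnessLib

/-!
# Exact factorisation of the crux `KineticFluxLdDecay` through the line `meso-window-split`
# (stmt-AtomisticToContinuum-10967; routes AntiMazurCoboundaries r4 / FluxGibbsianityLdDrude r2)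

Registered sub-goal `stub_mesoFactorization` of the line (lead c3). With the monotone bridge
`stub_windowMonotone : WindowMonotone` LANDED (`…Theorems.AntiMazurCoboundariesKineticFluxLdDecayWindowMonotone`),
the two remaining content stubs of the line are each a CONSEQUENCE of the crux and jointly IMPLY it:

  `KineticFluxLdDecay ↔ (MesoDecay ∧ MesoLocality)`     (`kineticFluxLdDecay_iff_mesoDecay_and_mesoLocality`).

* `⇐` (`crux_of_mesoDecay_of_mesoLocality`, the planner's composition `crux_of_parts` with the landed bridge):
  `σ₀ := min σ_Meso σ_Loc ½` (clause (A) of the crux = `isProbabilityMeasure_localGibbsLaw`), `κ := min (κ_Meso/C) κ_Loc`,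
  `δ₁ := min δ 1/(κ_Meso + 2)`, `M := max N₁ N₂`, `τ := (M+1)^{γ₀}`, `N₀ := N₃`: `MesoDecay` gives a horizon `τ₁ ≤ δ₁ τ_M`
  at size `M` for the inflated observable `C·g`, the bridge lifts it to `τ_M` at level `δ₁(1+κ_Meso)` (invariance
  `Theorems.measurePreserving_flow_localGibbsLaw_const`, `ae_mem_good_localGibbsLaw`), `MesoLocality` transfers it to
  every `N ≥ N₃` at level `δ₁(2+κ_Meso) = min δ 1 ≤ δ`.
* `⇒`: `mesoDecay_of_crux` (take the crux's `τ(δ)` and `M` so large that `τ ≤ δ(M+1)^γ`) and `mesoLocality_of_crux`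
  (`C = 1`; the crux at tolerance `ε/2` and its own window `τ(ε/2)ℓ_N`, lifted to the reference window `(M+1)^γ ℓ_N` by the
  bridge, remainder `τκ/(M+1)^γ ≤ ε/2` for `M ≥ N₂`; the size-`M` hypothesis of `MesoLocality` is not used — found by the
  wave-1 stub worker of `stub_localityTransfer`).

WHAT THIS RECORDS (line verdict, `Cruxes/KineticFluxLdDecay/Lines/meso_window_split.dead.md`): the line's distinctive lever —
deriving `MesoLocality` by statics from an exponential-moment LIGHT CONE for the bad-forecast COUNT (`LightConeMeso`) — is
refuted on paper for every exponent (steered dispersal cascades / static near-contact rows make the cost per corrupted forecast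
`→ 0` as the mesoscopic horizon grows), so what survives of the line is exactly this factorisation: the crux splits into
DECAY ON SOME SUB-POLYNOMIAL HORIZON AT EACH SIZE (`MesoDecay`, horizon may depend on the size) and LOCALITY OF THE WINDOW
PRESSURE ACROSS SIZES (`MesoLocality`, decay-free), both strictly weaker-looking than the crux, neither with a known proof route.
-/

noncomputable section

open MeasureTheory Set Filter
open scoped ENNReal Classical

namespace Summit.AtomisticToContinuum.HydrodynamicLimit.Theorems.MesoWindowSplit

open Literature.MathematicalPhysics.KineticTheory (T3 V3 hsDiameter localGibbsLaw)
open Literature.Analysis.FluidPDE (HardSphereFlow Config localClusterState)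
open Summit.AtomisticToContinuum.HydrodynamicLimit.Theses.FluxGibbsianityLdDrude (KineticFluxLdDecay)

/-- **`⇐`: composition of the line with the landed bridge.** Mesoscopic decay + mesoscopic locality give the crux
(body spelled with the frame abbreviations; definitionally the route decl). -/
theorem crux_of_mesoDecay_of_mesoLocality (hmeso : MesoDecay) (hloc : MesoLocality) : KineticFluxLdDecay := by
  intro a θ u₀ ha hθ
  obtain ⟨σ₁, hσ₁, H₁⟩ := hmeso a θ u₀ ha hθ
  obtain ⟨σ₂, hσ₂, H₂⟩ := hloc a θ u₀ ha hθ
  refine ⟨min (min σ₁ σ₂) (1 / 2), lt_min (lt_min hσ₁ hσ₂) (by norm_num), fun σ hσ hσlt => ?_⟩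
  have hσ₁' : σ < σ₁ := lt_of_lt_of_le hσlt ((min_le_left _ _).trans (min_le_left _ _))
  have hσ₂' : σ < σ₂ := lt_of_lt_of_le hσlt ((min_le_left _ _).trans (min_le_right _ _))
  have hσhalf : σ ≤ 1 / 2 := (lt_of_lt_of_le hσlt (min_le_right _ _)).le
  have hP : ∀ (N : ℕ) (Φ : Flow σ N), IsProbabilityMeasure (gibbs σ a θ u₀ N Φ) := fun N Φ =>
    Literature.MathematicalPhysics.KineticTheory.isProbabilityMeasure_localGibbsLaw
      continuous_const continuous_const continuous_const (fun _ => ha) (fun _ => hθ) hσhalf N Φ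
  refine ⟨hP, ?_⟩
  obtain ⟨κ₁, hκ₁, G₁⟩ := H₁ σ hσ hσ₁'
  obtain ⟨γ₀, hγ₀, C, hC, κ₂, hκ₂, G₂⟩ := H₂ σ hσ hσ₂'
  have hCpos : 0 < C := one_pos.trans_le hC
  refine ⟨min (κ₁ / C) κ₂, lt_min (div_pos hκ₁ hCpos) hκ₂, fun φ g hφ hg hφ1 hgκ horth δ hδ => ?_⟩
  -- the inflated observable `C·g` is admissible for `MesoDecay`
  have hgC : ∀ v, |C * g v| ≤ κ₁ := fun v => by
    rw [abs_mul, abs_of_pos hCpos]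
    calc C * |g v| ≤ C * (κ₁ / C) :=
          mul_le_mul_of_nonneg_left ((hgκ v).trans (min_le_left _ _)) hCpos.le
      _ = κ₁ := mul_div_cancel₀ κ₁ hCpos.ne'
  have hg₂ : ∀ v, |g v| ≤ κ₂ := fun v => (hgκ v).trans (min_le_right _ _)
  have hgCcont : Continuous fun v => C * g v := continuous_const.mul hg
  have horthC : Orthogonal fun v => C * g v := fun c₀ c₂ b => by
    have h0 := horth c₀ c₂ b
    simp_rw [mul_assoc]
    rw [integral_const_mul, h0, mul_zero]
  -- tolerances
  set δ₁ : ℝ := min δ 1 / (κ₁ + 2) with hδ₁def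
  have hk2 : 0 < κ₁ + 2 := by linarith
  have hδ₁ : 0 < δ₁ := div_pos (lt_min hδ one_pos) hk2
  have hδ₁le : δ₁ ≤ 1 := by
    rw [hδ₁def, div_le_one hk2]
    exact (min_le_right _ _).trans (by linarith)
  -- mesoscopic decay for `C·g`, locality for `g`, both at exponent `γ₀` and tolerance `δ₁`
  obtain ⟨N₁, K₁⟩ := G₁ φ (fun v => C * g v) hφ hgCcont hφ1 hgC horthC γ₀ hγ₀ δ₁ hδ₁
  obtain ⟨N₂, K₂⟩ := G₂ φ g hφ hg hφ1 hg₂ horth γ₀ hγ₀ le_rfl δ₁ hδ₁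
  set M : ℕ := max N₁ N₂ with hMdef
  obtain ⟨τ₁, hτ₁, hτ₁le, Hτ₁⟩ := K₁ M (le_max_left _ _)
  have hscale : 0 < scale M := Real.rpow_pos_of_pos (by positivity) _
  have hhor : 0 < horizon γ₀ M := Real.rpow_pos_of_pos (by positivity) _
  obtain ⟨-, -, hmeas, hbdd⟩ := stub_mesoObjects
  -- the monotone bridge lifts the bound from Meso's horizon `τ₁` to the reference horizon `τ_M`
  have hA : ∀ Φ' : Flow σ M, ldLHS σ a θ u₀ φ (fun v => C * g v) (horizon γ₀ M * scale M) M Φ'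
      ≤ ENNReal.ofReal (Real.exp ((δ₁ * (1 + κ₁)) * (M + 1))) := by
    intro Φ'
    haveI := hP M Φ'
    have hinv : ∀ t, MeasurePreserving (Φ'.flow t) (gibbs σ a θ u₀ M Φ') (gibbs σ a θ u₀ M Φ') :=
      fun t => Summit.AtomisticToContinuum.HydrodynamicLimit.Theorems.measurePreserving_flow_localGibbsLaw_const
        σ a θ u₀ M Φ' t
    have hgood : ∀ᵐ z ∂(gibbs σ a θ u₀ M Φ'), z ∈ Φ'.good :=
      Literature.MathematicalPhysics.KineticTheory.ae_mem_good_localGibbsLaw σ _ _ _ M Φ'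
    have hFm : Measurable (fluxObs θ u₀ φ (fun v => C * g v) M) := hmeas θ u₀ φ _ hφ hgCcont M
    have hFb : ∀ z, |fluxObs θ u₀ φ (fun v => C * g v) M z| ≤ (M + 1) * κ₁ := hbdd θ κ₁ u₀ φ _ hφ1 hgC M
    have hle : τ₁ * scale M ≤ horizon γ₀ M * scale M :=
      mul_le_mul_of_nonneg_right (hτ₁le.trans (mul_le_of_le_one_left hhor.le hδ₁le)) hscale.le
    have hApos : 0 ≤ δ₁ * (M + 1) := by positivity
    have key := stub_windowMonotone (hsDiameter σ M) M Φ' (gibbs σ a θ u₀ M Φ') (hP M Φ') hinv hgood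
      (fluxObs θ u₀ φ (fun v => C * g v) M) ((M + 1) * κ₁) hFm hFb (τ₁ * scale M)
      (horizon γ₀ M * scale M) (δ₁ * (M + 1)) (mul_pos hτ₁ hscale) hle hApos (Hτ₁ Φ')
    refine key.trans (ENNReal.ofReal_le_ofReal (Real.exp_le_exp.2 ?_))
    have hratio : τ₁ * scale M / (horizon γ₀ M * scale M) ≤ δ₁ := by
      rw [mul_div_mul_right _ _ hscale.ne', div_le_iff₀ hhor]
      exact hτ₁le
    have hM1 : (0 : ℝ) ≤ (M + 1) * κ₁ := by positivity
    nlinarith [mul_le_mul_of_nonneg_right hratio hM1]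
  obtain ⟨N₃, K₃⟩ := K₂ M (le_max_right _ _) (δ₁ * (1 + κ₁)) (by positivity) hA
  refine ⟨horizon γ₀ M, hhor, N₃, fun N hN Φ => ?_⟩
  refine (K₃ N hN Φ).trans (ENNReal.ofReal_le_ofReal (Real.exp_le_exp.2 ?_))
  have hN1 : (0 : ℝ) ≤ (N : ℝ) + 1 := by positivity
  have h2 : δ₁ * (1 + κ₁) + δ₁ = min δ 1 := by
    rw [hδ₁def]
    field_simp
    ring
  have h3 : δ₁ * (1 + κ₁) + δ₁ ≤ δ := by linarith [min_le_left δ 1]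
  exact mul_le_mul_of_nonneg_right h3 hN1

/-- **`⇒`, decay half**: `KineticFluxLdDecay → MesoDecay` — take the crux's `τ(δ)` and `M` so large that
`τ ≤ δ (M+1)^γ` (so `MesoDecay` is a consequence of the crux; it is strictly weaker-looking because its horizon may
depend on the size). -/
theorem mesoDecay_of_crux (h : KineticFluxLdDecay) : MesoDecay := by
  intro a θ u₀ ha hθ
  obtain ⟨σ₀, hσ₀, H⟩ := h a θ u₀ ha hθ
  refine ⟨σ₀, hσ₀, fun σ hσ hσlt => ?_⟩
  obtain ⟨-, κ, hκ, Hκ⟩ := H σ hσ hσlt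
  refine ⟨κ, hκ, fun φ g hφ hg hφ1 hgκ horth γ hγ δ hδ => ?_⟩
  obtain ⟨τ, hτ, N₀, HN⟩ := Hκ φ g hφ hg hφ1 hgκ horth δ hδ
  obtain ⟨K, hK⟩ := exists_nat_ge ((τ / δ) ^ (1 / γ))
  refine ⟨max N₀ K, fun M hM => ⟨τ, hτ, ?_, fun Φ => HN M ((le_max_left _ _).trans hM) Φ⟩⟩
  have hM' : (K : ℝ) ≤ (M : ℝ) := by exact_mod_cast (le_max_right _ _).trans hM
  have hbase : (τ / δ) ^ (1 / γ) ≤ ((M + 1 : ℕ) : ℝ) := by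
    push_cast
    linarith
  have hpow : τ / δ ≤ horizon γ M := by
    have h1 : ((τ / δ) ^ (1 / γ)) ^ γ ≤ (((M + 1 : ℕ) : ℝ)) ^ γ :=
      Real.rpow_le_rpow (Real.rpow_nonneg (div_pos hτ hδ).le _) hbase hγ.le
    have h2 : ((τ / δ) ^ (1 / γ)) ^ γ = τ / δ := by
      rw [← Real.rpow_mul (div_pos hτ hδ).le, one_div, inv_mul_cancel₀ hγ.ne', Real.rpow_one]
    rw [h2] at h1
    exact h1
  rwa [div_le_iff₀' hδ] at hpow

/-- **`⇒`, locality half**: `KineticFluxLdDecay → MesoLocality` with `C = 1`, `γ₀ = 1`, `κ = κ_crux`,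
`N₃ = N₀(ε/2)`; the size-`M` hypothesis of `MesoLocality` is not used (the crux at tolerance `ε/2` lifted to the
reference window by the landed bridge). -/
theorem mesoLocality_of_crux (h : KineticFluxLdDecay) : MesoLocality := by
  intro a θ u₀ ha hθ
  obtain ⟨σ₁, hσ₁, H⟩ := h a θ u₀ ha hθ
  refine ⟨σ₁, hσ₁, fun σ hσ hσlt => ?_⟩
  obtain ⟨hP, κ, hκ, Hκ⟩ := H σ hσ hσlt
  refine ⟨1, one_pos, 1, le_rfl, κ, hκ, fun φ g hφ hg hφ1 hgκ horth γ hγ _ ε hε => ?_⟩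
  obtain ⟨τ, hτ, N₀, HN⟩ := Hκ φ g hφ hg hφ1 hgκ horth (ε / 2) (half_pos hε)
  set L : ℝ := max τ (2 * κ * τ / ε) with hLdef
  have hlim : Tendsto (fun M : ℕ => horizon γ M) atTop atTop :=
    (tendsto_rpow_atTop hγ).comp (tendsto_natCast_atTop_atTop.comp (tendsto_add_atTop_nat 1))
  obtain ⟨N₂, hN₂⟩ := Filter.eventually_atTop.1 (hlim.eventually_ge_atTop L)
  refine ⟨N₂, fun M hM A hA _ => ⟨N₀, fun N hN Φ => ?_⟩⟩
  have hhor : L ≤ horizon γ M := hN₂ M hM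
  have hhorpos : 0 < horizon γ M := Real.rpow_pos_of_pos (by positivity) _
  have hscale : 0 < scale N := Real.rpow_pos_of_pos (by positivity) _
  haveI := hP N Φ
  have hinv : ∀ t, MeasurePreserving (Φ.flow t) (gibbs σ a θ u₀ N Φ) (gibbs σ a θ u₀ N Φ) := fun t =>
    Summit.AtomisticToContinuum.HydrodynamicLimit.Theorems.measurePreserving_flow_localGibbsLaw_const
      σ a θ u₀ N Φ t
  have hgood : ∀ᵐ z ∂(gibbs σ a θ u₀ N Φ), z ∈ Φ.good :=
    Literature.MathematicalPhysics.KineticTheory.ae_mem_good_localGibbsLaw σ _ _ _ N Φ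
  obtain ⟨-, -, hmeas, hbdd⟩ := stub_mesoObjects
  have hFm : Measurable (fluxObs θ u₀ φ g N) := hmeas θ u₀ φ g hφ hg N
  have hFb : ∀ z, |fluxObs θ u₀ φ g N z| ≤ (N + 1) * κ := hbdd θ κ u₀ φ g hφ1 hgκ N
  have hle : τ * scale N ≤ horizon γ M * scale N :=
    mul_le_mul_of_nonneg_right ((le_max_left _ _).trans hhor) hscale.le
  have hApos : 0 ≤ ε / 2 * (N + 1) := by positivity
  have key := stub_windowMonotone (hsDiameter σ N) N Φ (gibbs σ a θ u₀ N Φ) (hP N Φ) hinv hgood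
    (fluxObs θ u₀ φ g N) ((N + 1) * κ) hFm hFb (τ * scale N) (horizon γ M * scale N) (ε / 2 * (N + 1))
    (mul_pos hτ hscale) hle hApos (HN N hN Φ)
  refine key.trans (ENNReal.ofReal_le_ofReal (Real.exp_le_exp.2 ?_))
  have hratio : τ * scale N / (horizon γ M * scale N) * ((N + 1) * κ) ≤ ε / 2 * (N + 1) := by
    rw [mul_div_mul_right _ _ hscale.ne']
    have h2 : 2 * κ * τ / ε ≤ horizon γ M := (le_max_right _ _).trans hhor
    have h3 : 2 * κ * τ ≤ horizon γ M * ε := by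
      rwa [div_le_iff₀ hε] at h2
    rw [div_mul_eq_mul_div, div_le_iff₀ hhorpos]
    have hN1 : (0 : ℝ) ≤ (N : ℝ) + 1 := by positivity
    nlinarith [mul_le_mul_of_nonneg_right h3 hN1]
  have hN1 : (0 : ℝ) ≤ (N : ℝ) + 1 := by positivity
  nlinarith [mul_nonneg hA hN1]

/-- STUB `stub_mesoFactorization` (registered sub-goal of the line; PROVED): **the crux factors exactly through the
line** — `KineticFluxLdDecay ↔ (MesoDecay ∧ MesoLocality)`. -/
theorem stub_mesoFactorization : KineticFluxLdDecay ↔ (MesoDecay ∧ MesoLocality) :=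
  ⟨fun h => ⟨mesoDecay_of_crux h, mesoLocality_of_crux h⟩,
    fun h => crux_of_mesoDecay_of_mesoLocality h.1 h.2⟩

/-- The same factorisation for the `AntiMazurCoboundaries` copy of the crux (the two route decls are the same term). -/
theorem kineticFluxLdDecay_iff_mesoDecay_and_mesoLocality :
    Summit.AtomisticToContinuum.HydrodynamicLimit.Theses.AntiMazurCoboundaries.KineticFluxLdDecay ↔
      (MesoDecay ∧ MesoLocality) :=
  stub_mesoFactorization

end Summit.AtomisticToContinuum.HydrodynamicLimit.Theorems.MesoWindowSplit

end
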